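import Summits.BirchSwinnertonDyer.Rank1Residual.ManinAdditive.NineShiftEqualiserLaw
import HarnessLib
import HarnessLib.Audit.Tags

/-!
# The PRIME-GENERIC SHIFT EQUALISER LAW «K_p(N) = D(N) for every prime p and every level N» — one vocabulary for all shifts
# (cell `bsd-f2-manin`; C2/C3 LEAD p1 g11 census + typing ask T-p1-g11-2; typer g17)

HONEST FRAMING.  LENS = the line LEAD's structure census (prover seat p1 g11, HOME/p1/CENSUS-shift-equaliser-p1-g11.md sha16
c59c91706c46897e; engine HOME/p1/g11/shift_equaliser_f2.py 8ab7051d709887c9: exact linear algebra over `𝔽_p`,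
`V(N) = Hom(Γ₀(N), 𝔽_p) = H¹(SL₂(ℤ), 𝔽_p[P¹(ℤ/N)])` by Shapiro, `K_t(N)` = the `t`-shift equaliser, `D(N)` = the diamond span).
The tree speaks THREE dialects of the same notion: es's `NineShiftEqualiser.IsAddChar / IsThreeShiftInvariant /
IsNineShiftInvariant / IsDiamondChar / RestrictsFrom` (values in `ZMod 3`, this file's import), the provers' `TwoShift.IsAdd /
IsTwoShiftInvariant / IsFourShiftInvariant / IsEightShiftInvariant / IsDiamond / RestrictsFrom` (any commutative ring `K`;
`Theorems/ManinLocalTwoThreeTwoShiftLaws.lean`, p3 g11) and the def-free binders of `Theorems/ManinLocalTwoThreeShiftCompatiblePairRigidity.lean`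
(p2 g12; `Gamma0.degeneracyConj` shape).  This file types the vocabulary ONCE, generic in the shift `t : ℤ` and the coefficients
`K`: `ShiftEqualiser.IsAdd`, `IsShiftInvariant t`, `IsDiamond`, `RestrictsFrom`, the single-level schema
`ShiftInvariantIsDiamondAt K t N`, and the LEAD's prime-generic law **`PrimeShiftInvariantIsDiamond`** as an `@[conjecture]`
obligation node (nothing asserted).  The es dialect is recovered DEFINITIONALLY (`Iff.rfl` bridges below: `isAddChar_iff`,
`isThreeShiftInvariant_iff`, `isNineShiftInvariant_iff`, `isDiamondChar_iff`, `restrictsFrom_iff`, `threeShiftInvariantIsDiamondAt_iff`);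
the `TwoShift` dialect likewise at `t = 2, 4, 8` (bridges in the theorem-side sibling, which may import prover files).
PROVED here (generic sanity, any `t`, any `K`): `D ⊆ K_t` for additive maps (`isShiftInvariant_of_isDiamond`), `K_s ∩ K_t ⊆ K_{s·t}`
(`isShiftInvariant_mul`), hence `K_t ⊆ K_{t²}`.

WHAT IS CLAIMED (p1 census, not the tree).  **For EVERY prime `p` and EVERY level `N`: an additive `φ : Γ₀(N) → 𝔽_p` with
`φ(a, pb; c, d) = φ(a, b; pc, d)` for all `(a b; pc d) ∈ Γ₀(pN)` (p-shift invariance) is a DIAMOND class (kills `Γ₁(N)`).**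
Equivalently `ker(π₁* − π_p* : H¹(Γ₀(N), 𝔽_p) → H¹(Γ₀(pN), 𝔽_p)) = Hom((ℤ/N)ˣ, 𝔽_p) ∘ d` — Ihara's lemma with TRIVIAL `𝔽_p`
coefficients, Eisenstein part INCLUDED, at every level including `p ∣ N` and `p² ∣ N`.  NOT IN PRINT in this form (nearest print
BY NAME: Ihara's lemma for the degeneracy maps `J₀(N)² → J₀(Np)`, `p ∤ N` (Ribet, Invent. Math. 100 (1990) — not held,
acq-09883, locator deliberately not quoted); in the tree: `p ∤ N`, all `p` =
p2 g12 `ManinLocalTwoThree.shiftInvariant_isDiamond` (p683739, def-free binders); `p = 3`, all `N` = p1 g11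
`threeShiftInvariantIsDiamondAt_all` (p684847); `t = 9`, all `N` = `nineShiftInvariantIsDiamondAt_all`; `p = 2`: odd `N` = p2
`twoShiftInvariant_isDiamond`, `2M` with `M` odd = p1 g12 `TwoShiftTransfer.twoShiftInvariantIsDiamondAt_two_mul` (p687341), the
`2`-power tower = p3 g11 `twoShiftInvariantIsDiamondAt_of_two_mul`; the typed `p = 2` law is `TwoShift.TwoShiftInvariantIsDiamond`).
OPEN (predicted TRUE by the LEAD): `p ≥ 5` with `p ∣ N` (the `K_{p,p}` steps: p2 g12 `Theorems/ManinLocalTwoThreeHeisenbergLiftFiveLe.lean`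
+ Gaschütz averaging supply the Heisenberg input at every level; the assembly is the provers').
BC5 (census witness): CENSUS-shift-equaliser-p1-g11.md c59c91706c46897e — `K_t(N) = D(N)` at 55/55 cells `(p, t, N)`:
`p = 3` (`t = 3, 9`; `N ≤ 45` incl. `3 ∤ N`, `3 ∥ N`), `p = 2` (`t = 2, 4, 8`; `N ≤ 28` incl. odd, `2 ∥ N`, `4 ∣ N`), `p = 5`
(`N ∈ {1, 2, 3, 5, 10, 11, 25}`), `p = 7` (`N ∈ {1, 7, 14, 49}`); 0 violations; `D ⊆ K_t` checked at every cell
(`dim(K_t + D) = dim K_t`).  Second engines on sub-ranges: es ENGINE 4 (`p = 3`), p3 g11 rs_equaliser.py (`p = 2`,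
Reidemeister–Schreier over `𝔽₂`: `t = 8` at all 13 levels `4 ∣ N ≤ 48`, `t = 2` at all `N ≤ 35`).
REFUTER VERDICTS: none requested at filing (LEAD census row; ref1 audits of the `p = 3` / `p = 2` instances: §R97, §R106-type
by-name probes CLEAN).  WHY NOVEL (LEAD): one law for all primes whose `p = 3` / `p = 2` instances are exactly the f-free
Eisenstein equaliser inputs of C3 (`PlusIndexPrimeTo 3` via E-es-94♯) and C2 (G₂/G₈); the Eisenstein part at `p ∣ N` is the
content print does not cover.  bears_on: stmt-BirchSwinnertonDyer-22967 (C2), stmt-BirchSwinnertonDyer-22968 (C3).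
PARTITION 0 · beyond-print theorem: no (a typed LAW + census; its `p = 2, 3` instances are tree theorems / imminent) · BSD is
not proved by this; Manin's conjecture is not proved; C2/C3 OPEN — these are structure statements about `Γ₀(N)` alone.
References: cell files above; [cite: DarmonDiamondTaylor1995, Lemma 4.28 (p. 135) (degeneracy maps on Γ₀; shape only — the
𝔽_p-coefficient equaliser law at p ∣ N is the cell's, NOT in print)].
-/

set_option autoImplicit false

open scoped MatrixGroups

open CongruenceSubgroup Matrix.SpecialLinearGroup
open Summit.BirchSwinnertonDyer.Rank1Residual.ManinAdditive.NineShiftEqualiser (slOf g0Of slOf_apply_00 slOf_apply_01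
  slOf_apply_10 slOf_apply_11 slOf_mem_gamma0 g0Of_congr)

namespace Summit.BirchSwinnertonDyer.Rank1Residual.ManinAdditive.ShiftEqualiser

/-! ### §1. Vocabulary, generic in the shift `t : ℤ` and the coefficients `K` -/

section Vocabulary

variable {K : Type*}

/-- `φ : Γ₀(N) → K` is ADDITIVE (a homomorphism to the additive structure of `K`).  Same body as es's
`NineShiftEqualiser.IsAddChar` (`K = ℤ/3`) and the provers' `TwoShift.IsAdd`. [folklore] -/
def IsAdd [Add K] {N : ℕ} (φ : Gamma0 N → K) : Prop :=
  ∀ γ δ : Gamma0 N, φ (γ * δ) = φ γ + φ δ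

/-- `φ` is INVARIANT UNDER THE `t`-SHIFT: `φ(a, tb; c, d) = φ(a, b; tc, d)` for every `(a b; tc d) ∈ Γ₀(tN)`, i.e.
`φ(diag(t,1) γ diag(t,1)⁻¹) = φ(γ)` on `Γ₀(tN)` (`π₁^* φ = π_t^* φ`).  At `t = 3, 9` this is es's `IsThreeShiftInvariant` /
`IsNineShiftInvariant`, at `t = 2, 4, 8` the provers' `IsTwoShiftInvariant` / `IsFourShiftInvariant` / `IsEightShiftInvariant`
— all by `Iff.rfl`. [cite: DarmonDiamondTaylor1995, Lemma 4.28 (p. 135) (the two degeneracy embeddings of Γ₀(tN) in Γ₀(N); shape only)] -/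
def IsShiftInvariant (t : ℤ) {N : ℕ} (φ : Gamma0 N → K) : Prop :=
  ∀ (a b c d : ℤ) (hdet : a * d - b * (t * c) = 1) (hc : (N : ℤ) ∣ c),
    φ (g0Of a (t * b) c d (by linear_combination hdet) hc)
      = φ (g0Of a b (t * c) d hdet (Dvd.dvd.mul_left hc t))

/-- `φ` is a DIAMOND class: it vanishes on `Γ₁(N)` (for additive `φ`: `φ = χ ∘ (d mod N)` for an additive character `χ` of
`(ℤ/N)ˣ`, i.e. `φ` comes from the Shimura covering `X₁(N) → X₀(N)`).  Same body as `NineShiftEqualiser.IsDiamondChar` /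
`TwoShift.IsDiamond`. [folklore] -/
def IsDiamond [Zero K] {N : ℕ} (φ : Gamma0 N → K) : Prop :=
  ∀ (γ : SL(2, ℤ)) (hγ : γ ∈ Gamma1 N), φ ⟨γ, Gamma1_in_Gamma0 N hγ⟩ = 0

/-- `φ : Γ₀(N) → K` is the RESTRICTION of `w : Γ₀(M) → K` (entrywise; used with `M ∣ N`).  Same body as
`NineShiftEqualiser.RestrictsFrom` / `TwoShift.RestrictsFrom`. [folklore] -/
def RestrictsFrom {M N : ℕ} (φ : Gamma0 N → K) (w : Gamma0 M → K) : Prop :=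
  ∀ (a b c d : ℤ) (hdet : a * d - b * c = 1) (hcN : (N : ℤ) ∣ c) (hcM : (M : ℤ) ∣ c),
    φ (g0Of a b c d hdet hcN) = w (g0Of a b c d hdet hcM)

variable (K)

/-- single-level schema `K_t(N) = D(N)` over `K`: every additive `t`-shift-invariant `φ : Γ₀(N) → K` is a diamond class.
At `(K, t) = (ℤ/3, 3)` this is es's `ThreeShiftInvariantIsDiamondAt N`, at `(ℤ/2, 2)` the provers' `TwoShiftInvariantIsDiamondAt N`
(`Iff.rfl`). [folklore] -/
def ShiftInvariantIsDiamondAt [Add K] [Zero K] (t : ℤ) (N : ℕ) : Prop :=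
  ∀ φ : Gamma0 N → K, IsAdd φ → IsShiftInvariant t φ → IsDiamond φ

end Vocabulary

/-! ### §2. The LEAD's prime-generic law (obligation node, nothing asserted) -/

/-- **LAW (K_p = D, every prime, every level) `PrimeShiftInvariantIsDiamond`** (LEAD p1 g11 census, T-p1-g11-2): for EVERY
prime `p` and EVERY level `N`, every additive `φ : Γ₀(N) → ℤ/p` invariant under the `p`-shift `γ ↦ diag(p,1) γ diag(p,1)⁻¹`
on `Γ₀(pN)` is a diamond class: `ker(π₁* − π_p*) = Hom((ℤ/N)ˣ, 𝔽_p) ∘ d` on `H¹(Γ₀(N), 𝔽_p)`, Eisenstein part included,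
also when `p ∣ N`.  KNOWN IN THE TREE (by name, see the module docstring): `p ∤ N` for all `p`; `p = 3` for all `N`;
`p = 2` for odd `N`, for `2M` with `M` odd, and up the `2`-power tower.  OPEN: `p ≥ 5`, `p ∣ N`.  CENSUS (BC5): 55/55 cells,
0 violations.  (`N = 0` is harmless: `Γ₀(0)` is the upper-triangular group and the statement holds there trivially for additive
`φ`, `(p − 1)·φ(T) = 0`.)  TYPER FRAMING: lens = LEAD structure census; LAW (obligation node), nothing asserted.
[conjecture — cell candidate, NOT a tree fact] [cite: DarmonDiamondTaylor1995, Lemma 4.28 (p. 135) (shape only — the p ∣ N Eisenstein-inclusive equaliser law is the cell's, NOT in print)] -/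
@[conjecture]
def PrimeShiftInvariantIsDiamond : Prop :=
  ∀ (p : ℕ), p.Prime → ∀ N : ℕ, ShiftInvariantIsDiamondAt (ZMod p) p N

/-- The law at ONE prime (schema in `p`; `p = 2`: the provers' G₂ `TwoShift.TwoShiftInvariantIsDiamond` up to the harmless level
`N = 0`; `p = 3`: es's E-es-96 at every level = the tree theorem `threeShiftInvariantIsDiamondAt_all`). [folklore] -/
def PrimeShiftInvariantIsDiamondAtPrime (p : ℕ) : Prop :=
  ∀ N : ℕ, ShiftInvariantIsDiamondAt (ZMod p) p N

/-- The global law is the conjunction over primes of its one-prime instances (`Iff.rfl`). [folklore] -/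
theorem primeShiftInvariantIsDiamond_iff :
    PrimeShiftInvariantIsDiamond ↔ ∀ p : ℕ, p.Prime → PrimeShiftInvariantIsDiamondAtPrime p := Iff.rfl

/-! ### §3. The es dialect (`ℤ/3`, `t = 3, 9`) is this vocabulary, definitionally -/

section EsDialect

open Summit.BirchSwinnertonDyer.Rank1Residual.ManinAdditive.NineShiftEqualiser
  (IsAddChar IsThreeShiftInvariant IsNineShiftInvariant IsDiamondChar ThreeShiftInvariantIsDiamondAt)

variable {M N : ℕ}

/-- es's `IsAddChar` is `IsAdd` at `K = ℤ/3`. [folklore] -/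
theorem isAddChar_iff (φ : Gamma0 N → ZMod 3) : IsAddChar φ ↔ IsAdd φ := Iff.rfl

/-- es's `IsThreeShiftInvariant` is `IsShiftInvariant 3`. [folklore] -/
theorem isThreeShiftInvariant_iff (φ : Gamma0 N → ZMod 3) : IsThreeShiftInvariant φ ↔ IsShiftInvariant 3 φ := Iff.rfl

/-- es's `IsNineShiftInvariant` is `IsShiftInvariant 9`. [folklore] -/
theorem isNineShiftInvariant_iff (φ : Gamma0 N → ZMod 3) : IsNineShiftInvariant φ ↔ IsShiftInvariant 9 φ := Iff.rfl

/-- es's `IsDiamondChar` is `IsDiamond` at `K = ℤ/3`. [folklore] -/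
theorem isDiamondChar_iff (φ : Gamma0 N → ZMod 3) : IsDiamondChar φ ↔ IsDiamond φ := Iff.rfl

/-- es's `RestrictsFrom` is `RestrictsFrom` at `K = ℤ/3`. [folklore] -/
theorem restrictsFrom_iff (φ : Gamma0 N → ZMod 3) (w : Gamma0 M → ZMod 3) :
    NineShiftEqualiser.RestrictsFrom φ w ↔ RestrictsFrom φ w := Iff.rfl

/-- es's single-level E-es-96 schema is `ShiftInvariantIsDiamondAt (ℤ/3) 3 N`. [folklore] -/
theorem threeShiftInvariantIsDiamondAt_iff (N : ℕ) :
    ThreeShiftInvariantIsDiamondAt N ↔ ShiftInvariantIsDiamondAt (ZMod 3) 3 N := Iff.rfl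

/-- Hence the `p = 3` instance of the prime-generic law is exactly «E-es-96 at every level» (a tree theorem,
`threeShiftInvariantIsDiamondAt_all`, cited by name in the theorem-side sibling). [folklore] -/
theorem primeShiftInvariantIsDiamondAtPrime_three_iff :
    PrimeShiftInvariantIsDiamondAtPrime 3 ↔ ∀ N : ℕ, ThreeShiftInvariantIsDiamondAt N := Iff.rfl

end EsDialect

/-! ### §4. Generic sanity (any shift, any coefficients): `D ⊆ K_t`, `K_s ∩ K_t ⊆ K_{st}` -/

section Sanity

variable {K : Type*} {N : ℕ}

/-- `K_1` is everything: the `1`-shift is the identity. [folklore] -/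
theorem isShiftInvariant_one (φ : Gamma0 N → K) : IsShiftInvariant 1 φ := by
  intro a b c d hdet hc
  exact congrArg φ (g0Of_congr rfl (one_mul b) (one_mul c).symm rfl _ _ _ _)

/-- `K_s ∩ K_t ⊆ K_{s·t}`: an `s`-shift-invariant and `t`-shift-invariant map is `(s·t)`-shift invariant
(`φ(a, stb; c, d) = φ(a, tb; sc, d) = φ(a, b; stc, d)`).  Special cases in the tree: `K₃ ⊆ K₉` (es), `K₂ ⊆ K₄ ⊆ K₈` (p3). [folklore] -/
theorem isShiftInvariant_mul {s t : ℤ} (φ : Gamma0 N → K) (hs : IsShiftInvariant s φ) (ht : IsShiftInvariant t φ) :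
    IsShiftInvariant (s * t) φ := by
  intro a b c d hdet hc
  have h1 := hs a (t * b) c d (by linear_combination hdet) hc
  have h2 := ht a b (s * c) d (by linear_combination hdet) (Dvd.dvd.mul_left hc s)
  have e1 : g0Of (M := N) a (s * t * b) c d (by linear_combination hdet) hc
      = g0Of a (s * (t * b)) c d (by linear_combination hdet) hc :=
    g0Of_congr rfl (by ring) rfl rfl _ _ _ _
  have e2 : g0Of (M := N) a b (s * t * c) d hdet (Dvd.dvd.mul_left hc (s * t))
      = g0Of a b (t * (s * c)) d (by linear_combination hdet) (Dvd.dvd.mul_left (Dvd.dvd.mul_left hc s) t) :=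
    g0Of_congr rfl rfl (by ring) rfl _ _ _ _
  have e3 : g0Of (M := N) a (t * b) (s * c) d (by linear_combination hdet) (Dvd.dvd.mul_left hc s)
      = g0Of a (t * b) (s * c) d (by linear_combination hdet) (Dvd.dvd.mul_left hc s) := rfl
  rw [e1, e2, h1, ← h2]

/-- `K_t ⊆ K_{t²}` (`K₃ ⊆ K₉`, `K₂ ⊆ K₄`). [folklore] -/
theorem isShiftInvariant_sq {t : ℤ} (φ : Gamma0 N → K) (ht : IsShiftInvariant t φ) :
    IsShiftInvariant (t * t) φ :=
  isShiftInvariant_mul φ ht ht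

/-- `D ⊆ K_t` for ADDITIVE maps: the two matrices `(a tb; c d)`, `(a b; tc d)` of `Γ₀(N)` differ by an element of `Γ₁(N)`
(same `d`, `N ∣ c`), so an additive diamond class takes the same value on them (the provers' `t = 2` proof, run at any `t`).
[folklore] -/
theorem isShiftInvariant_of_isDiamond [AddGroup K] (t : ℤ) (φ : Gamma0 N → K) (hadd : IsAdd φ) (hD : IsDiamond φ) :
    IsShiftInvariant t φ := by
  intro a b c d hdet hc
  set γ₁ : Gamma0 N := g0Of a (t * b) c d (by linear_combination hdet) hc with hγ₁
  set γ₂ : Gamma0 N := g0Of a b (t * c) d hdet (Dvd.dvd.mul_left hc t) with hγ₂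
  have hcN : ((c : ℤ) : ZMod N) = 0 := (ZMod.intCast_zmod_eq_zero_iff_dvd c N).mpr hc
  have had : ((a : ℤ) : ZMod N) * d = 1 := by
    have : ((a * d - b * (t * c) : ℤ) : ZMod N) = 1 := by rw [hdet]; push_cast; rfl
    push_cast at this; rw [hcN] at this; simpa using this
  have hmem : ((γ₁ * γ₂⁻¹ : Gamma0 N) : SL(2, ℤ)) ∈ Gamma1 N := by
    rw [Gamma1_mem]
    simp only [hγ₁, hγ₂, g0Of, slOf, Subgroup.coe_mul, Subgroup.coe_inv,
      Matrix.SpecialLinearGroup.coe_mul, Matrix.SpecialLinearGroup.coe_inv, Matrix.adjugate_fin_two,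
      Matrix.mul_apply, Fin.sum_univ_two, Matrix.of_apply, Matrix.cons_val', Matrix.cons_val_zero,
      Matrix.cons_val_one, Matrix.empty_val']
    push_cast
    rw [hcN]
    refine ⟨?_, ?_, ?_⟩
    · linear_combination had
    · linear_combination had
    · ring
  have hzero : φ (γ₁ * γ₂⁻¹) = 0 := by
    have := hD _ hmem
    have e : (γ₁ * γ₂⁻¹ : Gamma0 N) = ⟨((γ₁ * γ₂⁻¹ : Gamma0 N) : SL(2, ℤ)), Gamma1_in_Gamma0 N hmem⟩ :=
      Subtype.ext rfl
    rw [e]; exact this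
  have key : γ₁ = (γ₁ * γ₂⁻¹) * γ₂ := by group
  calc φ γ₁ = φ ((γ₁ * γ₂⁻¹) * γ₂) := by rw [← key]
    _ = φ (γ₁ * γ₂⁻¹) + φ γ₂ := hadd _ _
    _ = φ γ₂ := by rw [hzero, zero_add]

end Sanity

end Summit.BirchSwinnertonDyer.Rank1Residual.ManinAdditive.ShiftEqualiser
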